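import Summits.QuantumFields.YangMills.Theorems.BalabanUVNodesN21LowCentreNumeralBlock
import Summits.QuantumFields.YangMills.Theorems.BalabanUVNodesN21LowCentreNumeralSeam

/-!
# N21 (NE7c) · THE LOCATED CLAUSE OF THE LOW-CENTRE ROAD HOLDS «FOR g_k SUFFICIENTLY SMALL»: the profile
# `p₀(g) = A₀(log g⁻²)^{p₀}` grows without bound; explicit threshold, eventually, and uniformly along a flow
# (plan g77 W-SEAT-START-LIST §n21 item 1, fourth part)

Width seat pub-ymgap-dag-n21-w1 (g0; director-ym №197 ∕ HUMAN RULING D-0149), node N21 = NE7c (single-run shell-weight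
bound, NOT PRINTED in [Bałaban 1983–89], NOT proved), lane K3⁷ `SpineGivenEndpointR13SepCoPH` (stmt-QuantumFields-20544,
`--kind proof --supports … --as helper`).  Sequel of `…N21LowCentreNumeralBlock` (p587481): there the located numeral of
the low-centre road at [LF-II] §1's letters was reduced to ONE clause `16·W·d·(100M)^{d+1}·L² ≤ γ₀·(θ(1−ρ−σ))²`
(`numeral_at_sect1Letters`) with `W` the VALUE defect ((1.6) «e.g., the number 1» + «O(g_k^{1−β})|Λ|») — bounded —,
`γ₀∕(2d(100M)^{d+1})` the (1.9) coercivity — absolute at fixed `M` —, and the letter `θ` of the tested statistic living in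
the `1∕g_k`-RESCALED chart of (1.2) (`V′ = exp ig_kB′`, `|B′| < M₀g_k⁻¹ε_k`), hence proportional to
`ε_k∕g_k = p₀(g_k) = A₀(log g_k⁻²)^{p₀}` ([B14] (1.4), tree `Setup.p0Profile` ∕ `epsK`): `θ = κ₁·p₀(g_k)` with a located
species constant `κ₁ > 0` (`M₀` for the chart's coordinate letter; the plaquette letter's coefficient for a plaquette
statistic).  THIS FILE: §1 `p₀(g) → +∞` as `g → 0⁺` and `p₀` antitone on `(0,1]` [textbook]; §2 the clause from a profile
threshold `R` (`clause_sect1_of_profile_ge`), EVENTUALLY in the coupling (`eventually_clause_sect1`: print's standing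
«for g_k sufficiently small» ∕ [LF-I] p.186 «the conditions … do not depend on any scale»), and at EVERY level of a flow
whose couplings stay below one threshold `g⋆` (`clause_sect1_along_flow`); §3 ★ the defect numeral of
`…NumeralBlock.numeral_at_sect1Letters` at `θ = κ₁p₀(g)` from the threshold, and ★★ EVENTUALLY in `g`; §4 THE HISTORY
SEAM (ref-O READ-15 NIT-1 on p585816): a discrete Grönwall for the per-step (1.48) relations `B15.BasicStep.Ineq148`
BY NAME composes `…NumeralSeam`'s displayed history sum ∕ product — the oldest reading of a configuration whose newest
deviation vanishes is `≤ E∕15`, and ★ `numeral_of_history148` gives the numeral from `24·G ≤ γ·E` for every history length.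
So the dilation road's located numeral is NOT an independent estimate: at [LF-II] §1's letters it is implied by the
uniform smallness of the running coupling that print assumes throughout — LOCATED (the identification of the statistic's
letter with the chart letter is this seat's typing; `W̄`, `κ₁`, `γ₀`, `M`, `M₀` are hypotheses), nothing of Bałaban's
asserted.

HONEST FRAMING.  [textbook] real analysis (filters, `Real.log`) + the tree's `p0Profile`; 0 def, 0 sorry; NE7c NOT
PRINTED ∕ NOT proved; N21 NOT discharged; counts unmoved (typed 28∕28 · discharged 5∕27); count-neutral; one finite 𝕋⁴ at
fixed ε — R4 would close only the conditional finite-𝕋⁴ rung `BalabanLadder.UV`, NOT the Yang–Mills mass gap (Clay);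
nothing about ℝ⁴ ∕ OS.
-/

set_option autoImplicit false

open Filter Topology
open Literature.MathematicalPhysics.QuantumFieldTheory.Balaban1983to89 (p0Profile)

namespace Summit.QuantumFields.YangMills.Theorems.N21LowCentreNumeralFlow

/-! ## §1  The profile `p₀(g) = A₀(log g⁻²)^{p₀}` grows without bound as `g → 0⁺` and is antitone on `(0, 1]` -/

/-- `log (g²)⁻¹ → +∞` as `g → 0⁺`. [textbook] -/
theorem tendsto_log_inv_sq_nhdsGT_zero :
    Tendsto (fun g : ℝ => Real.log (g ^ 2)⁻¹) (𝓝[>] (0 : ℝ)) atTop := by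
  have h1 : Tendsto (fun g : ℝ => g ^ 2) (𝓝[>] (0 : ℝ)) (𝓝[>] (0 : ℝ)) := by
    refine tendsto_nhdsWithin_of_tendsto_nhds_of_eventually_within _ ?_ ?_
    · have : Tendsto (fun g : ℝ => g ^ 2) (𝓝 (0 : ℝ)) (𝓝 ((0 : ℝ) ^ 2)) := (continuous_pow 2).tendsto 0
      simpa using this.mono_left nhdsWithin_le_nhds
    · filter_upwards [self_mem_nhdsWithin] with g hg
      exact pow_pos (Set.mem_Ioi.1 hg) 2
  exact Real.tendsto_log_atTop.comp (tendsto_inv_nhdsGT_zero.comp h1)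

/-- **`p₀(g) → +∞` as `g → 0⁺`** (`A₀ > 0`, `p₀ ≥ 1`): the small-field letter in the `1∕g`-rescaled chart,
`ε_k∕g_k = p₀(g_k)` ([B14] (1.4): `ε_k = g_kp₀(g_k)`), grows without bound as the coupling goes to zero. [textbook] -/
theorem tendsto_p0Profile_nhdsGT_zero {A₀ : ℝ} (hA : 0 < A₀) {p₀ : ℕ} (hp : 1 ≤ p₀) :
    Tendsto (fun g : ℝ => p0Profile A₀ p₀ g) (𝓝[>] (0 : ℝ)) atTop := by
  unfold p0Profile
  refine Tendsto.const_mul_atTop hA ?_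
  exact (tendsto_pow_atTop (Nat.one_le_iff_ne_zero.1 hp)).comp tendsto_log_inv_sq_nhdsGT_zero

/-- `p₀` is ANTITONE in the coupling on `(0, 1]`: `0 < g ≤ g′ ≤ 1 ⇒ p₀(g′) ≤ p₀(g)` (`A₀ ≥ 0`). [textbook] -/
theorem p0Profile_antitone {A₀ g g' : ℝ} {p₀ : ℕ} (hA : 0 ≤ A₀) (hg : 0 < g) (hgg' : g ≤ g') (hg'1 : g' ≤ 1) :
    p0Profile A₀ p₀ g' ≤ p0Profile A₀ p₀ g := by
  unfold p0Profile
  refine mul_le_mul_of_nonneg_left ?_ hA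
  have hg' : 0 < g' := hg.trans_le hgg'
  have hlog0 : 0 ≤ Real.log (g' ^ 2)⁻¹ := by
    apply Real.log_nonneg
    rw [one_le_inv₀ (by positivity)]
    exact pow_le_one₀ hg'.le hg'1
  have hlog : Real.log (g' ^ 2)⁻¹ ≤ Real.log (g ^ 2)⁻¹ := by
    apply Real.log_le_log (by positivity)
    rw [inv_le_inv₀ (by positivity) (by positivity)]
    exact pow_le_pow_left₀ hg.le hgg' 2
  exact pow_le_pow_left₀ hlog0 hlog p₀

/-! ## §2  The clause of `numeral_at_sect1Letters` holds for `g_k` sufficiently small (explicit threshold; eventually) -/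

/-- **THE CLAUSE FROM A PROFILE THRESHOLD.**  If the letter of the tested statistic in the rescaled chart is
`θ = κ₁·p₀(g)` (`κ₁ > 0` a located species constant: `M₀` for the chart's coordinate letter `|B′| < M₀ε_k∕g_k`, or the
plaquette letter's coefficient over `4g_k` …), the value defect is bounded (`W ≤ W̄`), and `R ≥ 0` satisfies
`16·W̄·d·(100M)^{d+1}·L² ≤ γ₀·(κ₁R(1−ρ−σ))²`, then the clause of `…N21LowCentreNumeralBlock.numeral_at_sect1Letters` holds at
every coupling with `p₀(g) ≥ R`. [textbook] -/
theorem clause_sect1_of_profile_ge {W Wbar γ₀ M L ρ σ κ₁ R A₀ g : ℝ} {d p₀ : ℕ} (hW : W ≤ Wbar)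
    (hγ₀ : 0 ≤ γ₀) (hM : 0 < M) (hκ₁ : 0 ≤ κ₁) (hρσ : ρ + σ ≤ 1) (hR0 : 0 ≤ R)
    (hR : 16 * Wbar * d * (100 * M) ^ (d + 1) * L ^ 2 ≤ γ₀ * (κ₁ * R * (1 - ρ - σ)) ^ 2)
    (hg : R ≤ p0Profile A₀ p₀ g) :
    16 * W * d * (100 * M) ^ (d + 1) * L ^ 2 ≤ γ₀ * (κ₁ * p0Profile A₀ p₀ g * (1 - ρ - σ)) ^ 2 := by
  have hP : 0 ≤ (d : ℝ) * (100 * M) ^ (d + 1) * L ^ 2 := by positivity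
  have h1 : 16 * W * d * (100 * M) ^ (d + 1) * L ^ 2 ≤ 16 * Wbar * d * (100 * M) ^ (d + 1) * L ^ 2 := by
    nlinarith
  have h2 : κ₁ * R * (1 - ρ - σ) ≤ κ₁ * p0Profile A₀ p₀ g * (1 - ρ - σ) :=
    mul_le_mul_of_nonneg_right (mul_le_mul_of_nonneg_left hg hκ₁) (by linarith)
  have h3 : 0 ≤ κ₁ * R * (1 - ρ - σ) := mul_nonneg (mul_nonneg hκ₁ hR0) (by linarith)
  have h4 : (κ₁ * R * (1 - ρ - σ)) ^ 2 ≤ (κ₁ * p0Profile A₀ p₀ g * (1 - ρ - σ)) ^ 2 :=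
    pow_le_pow_left₀ h3 h2 2
  nlinarith [mul_le_mul_of_nonneg_left h4 hγ₀]

/-- **EVENTUALLY IN THE COUPLING.**  For `A₀ > 0`, `p₀ ≥ 1`, `γ₀ > 0`, `κ₁ > 0`, `ρ + σ < 1` and ANY bounded letters
`W, d, M, L`, the clause holds for all sufficiently small couplings `g > 0` — print's standing «for g_k sufficiently
small» ∕ «conditions … do not depend on any scale». [textbook] -/
theorem eventually_clause_sect1 {W γ₀ M L ρ σ κ₁ A₀ : ℝ} {d p₀ : ℕ} (hA : 0 < A₀) (hp : 1 ≤ p₀) (hγ₀ : 0 < γ₀)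
    (hκ₁ : 0 < κ₁) (hρσ : ρ + σ < 1) :
    ∀ᶠ g : ℝ in 𝓝[>] (0 : ℝ),
      16 * W * d * (100 * M) ^ (d + 1) * L ^ 2 ≤ γ₀ * (κ₁ * p0Profile A₀ p₀ g * (1 - ρ - σ)) ^ 2 := by
  -- `γ₀ (κ₁ p₀(g) (1−ρ−σ))² = (γ₀ κ₁² (1−ρ−σ)²) · p₀(g)²` and `p₀(g)² → ∞`
  have hc : 0 < γ₀ * (κ₁ * (1 - ρ - σ)) ^ 2 := by
    have : 0 < κ₁ * (1 - ρ - σ) := mul_pos hκ₁ (by linarith)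
    positivity
  have hsq : Tendsto (fun g : ℝ => p0Profile A₀ p₀ g ^ 2) (𝓝[>] (0 : ℝ)) atTop :=
    (tendsto_pow_atTop two_ne_zero).comp (tendsto_p0Profile_nhdsGT_zero hA hp)
  have hlim : Tendsto (fun g : ℝ => γ₀ * (κ₁ * (1 - ρ - σ)) ^ 2 * p0Profile A₀ p₀ g ^ 2) (𝓝[>] (0 : ℝ)) atTop :=
    Tendsto.const_mul_atTop hc hsq
  have hev := hlim.eventually_ge_atTop (16 * W * d * (100 * M) ^ (d + 1) * L ^ 2)
  filter_upwards [hev] with g hg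
  calc 16 * W * d * (100 * M) ^ (d + 1) * L ^ 2 ≤ γ₀ * (κ₁ * (1 - ρ - σ)) ^ 2 * p0Profile A₀ p₀ g ^ 2 := hg
    _ = γ₀ * (κ₁ * p0Profile A₀ p₀ g * (1 - ρ - σ)) ^ 2 := by ring

/-- **UNIFORMLY ALONG A FLOW WITH SMALL COUPLINGS.**  If every running coupling satisfies `0 < g_k ≤ g⋆ ≤ 1` and the
threshold `R ≤ p₀(g⋆)` certifies the clause (`clause_sect1_of_profile_ge`), then the clause holds at EVERY level `k`
(antitonicity of `p₀`): the located clause of the low-centre road is K-uniform under print's uniform smallness of the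
running coupling. [textbook] -/
theorem clause_sect1_along_flow {W Wbar γ₀ M L ρ σ κ₁ R A₀ gstar : ℝ} {d p₀ : ℕ} (g : ℕ → ℝ)
    (hW : W ≤ Wbar) (hγ₀ : 0 ≤ γ₀) (hM : 0 < M) (hκ₁ : 0 ≤ κ₁) (hρσ : ρ + σ ≤ 1) (hR0 : 0 ≤ R)
    (hA : 0 ≤ A₀) (hR : 16 * Wbar * d * (100 * M) ^ (d + 1) * L ^ 2 ≤ γ₀ * (κ₁ * R * (1 - ρ - σ)) ^ 2)
    (hstar1 : gstar ≤ 1) (hRstar : R ≤ p0Profile A₀ p₀ gstar) (hg : ∀ k, 0 < g k ∧ g k ≤ gstar) (k : ℕ) :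
    16 * W * d * (100 * M) ^ (d + 1) * L ^ 2 ≤ γ₀ * (κ₁ * p0Profile A₀ p₀ (g k) * (1 - ρ - σ)) ^ 2 :=
  clause_sect1_of_profile_ge hW hγ₀ hM hκ₁ hρσ hR0 hR
    (hRstar.trans (p0Profile_antitone hA (hg k).1 (hg k).2 hstar1))

/-! ## §3  The defect numeral at `θ = κ₁·p₀(g)`: from the threshold, and eventually in the coupling -/

open Summit.QuantumFields.YangMills.Theorems.N21LowCentreNumeralBlock (numeral_at_sect1Letters)

/-- ★ **THE DEFECT NUMERAL AT [LF-II] §1's LETTERS FROM A PROFILE THRESHOLD.**  `…NumeralBlock.numeral_at_sect1Letters`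
at the letter `θ = κ₁·p₀(g)`: a threshold `R` with `16·W̄·d·(100M)^{d+1}·L² ≤ γ₀·(κ₁R(1−ρ−σ))²` and `p₀(g) ≥ R` give
`2·0∕γ + √(2W∕γ) ≤ l₀·(θ(1−ρ) − c₀)∕L` (`γ = γ₀∕(2d(100M)^{d+1})`, core reading `c₀ ≤ σθ`). [textbook] -/
theorem numeral_at_sect1Letters_of_profile {W Wbar γ₀ M L ρ σ κ₁ R A₀ g c₀ l₀ : ℝ} {d p₀ : ℕ} (hd : 1 ≤ d)
    (hM : 0 < M) (hγ₀ : 0 < γ₀) (hκ₁ : 0 ≤ κ₁) (hL : 0 < L) (hl₀ : 1 / 2 ≤ l₀) (hρσ : ρ + σ ≤ 1)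
    (hθ : 0 ≤ κ₁ * p0Profile A₀ p₀ g) (hc₀ : c₀ ≤ σ * (κ₁ * p0Profile A₀ p₀ g)) (hW : W ≤ Wbar) (hR0 : 0 ≤ R)
    (hR : 16 * Wbar * d * (100 * M) ^ (d + 1) * L ^ 2 ≤ γ₀ * (κ₁ * R * (1 - ρ - σ)) ^ 2)
    (hg : R ≤ p0Profile A₀ p₀ g) :
    2 * 0 / (γ₀ / (2 * d * (100 * M) ^ (d + 1))) + Real.sqrt (2 * W / (γ₀ / (2 * d * (100 * M) ^ (d + 1))))
      ≤ l₀ * ((κ₁ * p0Profile A₀ p₀ g * (1 - ρ) - c₀) / L) :=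
  numeral_at_sect1Letters hd hM hγ₀ hθ hL hl₀ hρσ hc₀
    (clause_sect1_of_profile_ge hW hγ₀.le hM hκ₁ hρσ hR0 hR hg)

/-- ★★ **THE DEFECT NUMERAL HOLDS FOR ALL SUFFICIENTLY SMALL COUPLINGS.**  With the worst admissible core reading
`c₀ = σθ` and ANY fixed `W, d, M, L`: for `A₀ > 0`, `p₀ ≥ 1`, `γ₀ > 0`, `κ₁ > 0`, `ρ + σ < 1`, `L > 0`, `l₀ ≥ ½`, the defect
numeral of the low-centre road at `θ = κ₁·p₀(g)` holds for every `g > 0` small enough. [textbook] -/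
theorem eventually_numeral_at_sect1Letters {W γ₀ M L ρ σ κ₁ A₀ l₀ : ℝ} {d p₀ : ℕ} (hd : 1 ≤ d) (hM : 0 < M)
    (hA : 0 < A₀) (hp : 1 ≤ p₀) (hγ₀ : 0 < γ₀) (hκ₁ : 0 < κ₁) (hρσ : ρ + σ < 1) (hL : 0 < L) (hl₀ : 1 / 2 ≤ l₀) :
    ∀ᶠ g : ℝ in 𝓝[>] (0 : ℝ),
      2 * 0 / (γ₀ / (2 * d * (100 * M) ^ (d + 1))) + Real.sqrt (2 * W / (γ₀ / (2 * d * (100 * M) ^ (d + 1))))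
        ≤ l₀ * ((κ₁ * p0Profile A₀ p₀ g * (1 - ρ) - σ * (κ₁ * p0Profile A₀ p₀ g)) / L) := by
  have hpos : ∀ᶠ g : ℝ in 𝓝[>] (0 : ℝ), 0 ≤ p0Profile A₀ p₀ g :=
    (tendsto_p0Profile_nhdsGT_zero hA hp).eventually_ge_atTop 0
  filter_upwards [eventually_clause_sect1 (W := W) (M := M) (L := L) (d := d) hA hp hγ₀ hκ₁ hρσ, hpos] with g hg hg0
  exact numeral_at_sect1Letters hd hM hγ₀ (mul_nonneg hκ₁.le hg0) hL hl₀ hρσ.le le_rfl hg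

/-! ## §4  The history SEAM (ref-O READ-15 NIT-1 on p585816): composing the per-step (1.48) relations -/

section Seam

open Finset
open Literature.MathematicalPhysics.QuantumFieldTheory.Balaban1983to89
open Summit.QuantumFields.YangMills.Theorems.N21LowCentreNumeralSeam (historyTilt_le historyModulus_le)

/-- **DISCRETE GRÖNWALL FOR THE (1.48) RECURSION.**  If `dev m ≤ dev (m+1)·(1 + a m) + c m` for `m < n` with
`a m, c m ≥ 0`, then `dev 0 ≤ (∏_{m<n}(1 + a m))·(dev n + Σ_{m<n} c m)`. [textbook] -/
theorem history_recursion_bound (dev a c : ℕ → ℝ) (ha : ∀ m, 0 ≤ a m) (hc : ∀ m, 0 ≤ c m) :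
    ∀ n : ℕ, (∀ m < n, dev m ≤ dev (m + 1) * (1 + a m) + c m) →
      dev 0 ≤ (∏ m ∈ range n, (1 + a m)) * (dev n + ∑ m ∈ range n, c m) := by
  intro n
  induction n with
  | zero => intro _; simp
  | succ n ih =>
    intro h
    have h0 := ih fun m hm => h m (Nat.lt_succ_of_lt hm)
    have hn := h n (Nat.lt_succ_self n)
    have hP : 0 ≤ ∏ m ∈ range n, (1 + a m) := prod_nonneg fun m _ => by linarith [ha m]
    have hS : 0 ≤ ∑ m ∈ range n, c m := sum_nonneg fun m _ => hc m
    rw [prod_range_succ, sum_range_succ]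
    have h1 : dev n + ∑ m ∈ range n, c m ≤ (1 + a n) * (dev (n + 1) + (∑ m ∈ range n, c m + c n)) := by
      nlinarith [ha n, hc n, mul_nonneg (ha n) hS]
    calc dev 0 ≤ (∏ m ∈ range n, (1 + a m)) * (dev n + ∑ m ∈ range n, c m) := h0
      _ ≤ (∏ m ∈ range n, (1 + a m)) * ((1 + a n) * (dev (n + 1) + (∑ m ∈ range n, c m + c n))) :=
          mul_le_mul_of_nonneg_left h1 hP
      _ = (∏ m ∈ range n, (1 + a m)) * (1 + a n) * (dev (n + 1) + (∑ m ∈ range n, c m + c n)) := by ring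

/-- **THE CORE READING FROM THE (1.48) HISTORY, BY NAME.**  If the deviations along a history of `n` steps obey print's
(1.48) `B15.BasicStep.Ineq148 (dev m) (dev (m+1)) α β 2^{−(m+1)} E` (`m < n`) and the NEWEST deviation vanishes at the
centre (`dev n = 0`), then the OLDEST reading is `dev 0 ≤ (∏_{m<n}(1 + αβ2^{−(m+1)}))·(Σ_{m<n} αβ2^{−(m+1)})·E ≤ E∕15`
(`0 ≤ α ≤ 1∕8`, `0 ≤ β ≤ ½`, `E ≥ 0`) — the SEAM behind `…NumeralSeam.numeral_of_historyLetters`' displayed history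
sum∕product (ref-O READ-15 NIT-1). [textbook] -/
theorem coreReading_of_history148 {dev : ℕ → ℝ} {α β E : ℝ} {n : ℕ} (hα0 : 0 ≤ α) (hα : α ≤ 1 / 8) (hβ0 : 0 ≤ β)
    (hβ : β ≤ 1 / 2) (hE : 0 ≤ E)
    (h148 : ∀ m < n, B15.BasicStep.Ineq148 (dev m) (dev (m + 1)) α β ((1 / 2 : ℝ) ^ (m + 1)) E) (hn : dev n = 0) :
    dev 0 ≤ E / 15 := by
  have ha : ∀ m : ℕ, 0 ≤ α * β * (1 / 2 : ℝ) ^ (m + 1) := fun m => by positivity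
  have hc : ∀ m : ℕ, 0 ≤ α * β * (1 / 2 : ℝ) ^ (m + 1) * E := fun m => mul_nonneg (ha m) hE
  have hrec : ∀ m < n, dev m ≤ dev (m + 1) * (1 + α * β * (1 / 2 : ℝ) ^ (m + 1)) + α * β * (1 / 2 : ℝ) ^ (m + 1) * E := by
    intro m hm
    have h := h148 m hm
    unfold B15.BasicStep.Ineq148 at h
    exact h
  have h0 := history_recursion_bound dev (fun m => α * β * (1 / 2 : ℝ) ^ (m + 1))
    (fun m => α * β * (1 / 2 : ℝ) ^ (m + 1) * E) ha hc n hrec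
  rw [hn, zero_add] at h0
  obtain ⟨hP0, hP⟩ := historyModulus_le hα0 hα hβ0 hβ n
  have hsum : ∑ m ∈ range n, α * β * (1 / 2 : ℝ) ^ (m + 1) * E
      = (∑ m ∈ range n, α * β * (1 / 2 : ℝ) ^ (m + 1)) * E := by rw [sum_mul]
  have hS := historyTilt_le hα0 hβ0 hE n
  have hαβ : α * β ≤ 1 / 16 := by nlinarith [mul_le_mul hα hβ hβ0 (by norm_num : (0 : ℝ) ≤ 1 / 8)]
  have hS' : (∑ m ∈ range n, α * β * (1 / 2 : ℝ) ^ (m + 1)) * E ≤ E / 16 := by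
    have : α * β * E ≤ 1 / 16 * E := mul_le_mul_of_nonneg_right hαβ hE
    linarith
  have hS0 : 0 ≤ (∑ m ∈ range n, α * β * (1 / 2 : ℝ) ^ (m + 1)) * E :=
    mul_nonneg (sum_nonneg fun m _ => ha m) hE
  rw [hsum] at h0
  calc dev 0 ≤ (∏ m ∈ range n, (1 + α * β * (1 / 2 : ℝ) ^ (m + 1))) *
        ((∑ m ∈ range n, α * β * (1 / 2 : ℝ) ^ (m + 1)) * E) := h0
    _ ≤ 16 / 15 * (E / 16) := mul_le_mul hP hS' hS0 (by norm_num)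
    _ = E / 15 := by ring

/-- ★ **THE NUMERAL FROM THE (1.48) HISTORY RECURSION (the seam, proved).**  Slot letter `θ = (1 − β(1 − s∕2))·P·E`,
core reading `c₀ = dev 0` = the oldest deviation of a configuration whose newest deviation vanishes at the centre, the
per-step (1.48) relations BY NAME along the history, modulus `0 < L ≤ ∏_{m<n}(1 + αβ2^{−(m+1)})`, print's
`0 ≤ α ≤ 1∕8`, `0 ≤ β ≤ ½`, `0 ≤ s`, `P ≥ 1`, `E ≥ 0`, `ρ ≤ ½`, `l₀ ≥ ½`: `24·G ≤ γ·E` gives the numeral, for EVERY history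
length `n`. [textbook] -/
theorem numeral_of_history148 {dev : ℕ → ℝ} {G γ α β s P E ρ l₀ L : ℝ} {n : ℕ} (hγ : 0 < γ) (hα0 : 0 ≤ α)
    (hα : α ≤ 1 / 8) (hβ0 : 0 ≤ β) (hβ : β ≤ 1 / 2) (hs0 : 0 ≤ s) (hP : 1 ≤ P) (hE : 0 ≤ E) (hρ : ρ ≤ 1 / 2)
    (hl₀ : 1 / 2 ≤ l₀)
    (h148 : ∀ m < n, B15.BasicStep.Ineq148 (dev m) (dev (m + 1)) α β ((1 / 2 : ℝ) ^ (m + 1)) E) (hn : dev n = 0)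
    (hL0 : 0 < L) (hL : L ≤ ∏ m ∈ range n, (1 + α * β * (1 / 2 : ℝ) ^ (m + 1))) (hG : 24 * G ≤ γ * E) :
    2 * G / γ ≤ l₀ * (((1 - β * (1 - s / 2)) * P * E * (1 - ρ) - dev 0) / L) := by
  have hc₀ := coreReading_of_history148 hα0 hα hβ0 hβ hE h148 hn
  have hL' : L ≤ 16 / 15 := hL.trans (historyModulus_le hα0 hα hβ0 hβ n).2
  -- margin ≥ E/4 − E/15 = 11E/60; over L ≤ 16/15 and l₀ ≥ ½: ≥ 11E/128 ≥ E/12 = the clause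
  have hc : 1 / 2 ≤ 1 - β * (1 - s / 2) := by nlinarith
  have hcP : 1 / 2 ≤ (1 - β * (1 - s / 2)) * P := by nlinarith
  have hE1 : 0 ≤ E * (1 - ρ) := mul_nonneg hE (by linarith)
  have h1 : 1 / 4 * E ≤ (1 - β * (1 - s / 2)) * P * E * (1 - ρ) := by
    have h := mul_le_mul_of_nonneg_right hcP hE1
    nlinarith
  set M : ℝ := (1 - β * (1 - s / 2)) * P * E * (1 - ρ) - dev 0 with hMdef
  have hM : 11 / 60 * E ≤ M := by linarith
  have h2 : 2 * G / γ ≤ E / 12 := by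
    rw [div_le_iff₀ hγ]
    linarith
  have h3 : 11 * E / 64 ≤ M / L := by
    rw [le_div_iff₀ hL0]
    nlinarith
  have h4 : 0 ≤ M / L := le_trans (by positivity) h3
  have h5 : 1 / 2 * (M / L) ≤ l₀ * (M / L) := mul_le_mul_of_nonneg_right hl₀ h4
  linarith

end Seam

end Summit.QuantumFields.YangMills.Theorems.N21LowCentreNumeralFlow
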